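import Summits.CriticalPhenomena.PercolationContinuityZ3.Theorems.Transplant.PlanarSkeletonFrmDefs
import HarnessLib

/-!
# Frames-only skeletons from BASE-VERTEX data: the degree bound and the unit steps (ι) at every vertex are consequences of the frames

builds on p205010 (kernel theorem, internal audit signed; external expert review pending) — nothing in this file uses p205010; nothing
here is a claim about any open node.
Lane `prim-bschramm`, seat `prim-bschramm-p4` gen 14 (PART C3 of `P4-GENERAL.md`, §36: INPUT(G) as weak as possible).  Helper file
(`--supports stmt-CriticalPhenomena-4575 --as helper`).

The interfaces `PlanarSkeletonFrm` / `PlanarSkeletonNeg` ask for a degree bound `Δ` at EVERY vertex and outward unit steps (ι) at EVERY vertex.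
Both follow from the translating frames and the same data AT THE FINITELY MANY BASE VERTICES: a frame `α` with `α t = v` is a graph automorphism
(so `deg v = deg t`) translating the chart (so a unit step at `t` is carried to a unit step at `v`).  This file records the reduced input as
`PlanarSkeletonFrm.BaseData` / `PlanarSkeletonNeg.BaseData` with the constructors `toFrm` / `toNeg` (same `φ`, `types`, cylinders).  Together with
gen 14's Φ2 theorem (`PlanarSkeletonFrmCylStrict`), the input of the one-type nodes is: a 1-Lipschitz `φ`, transitive translating frames, unit steps
and connected cylinders AT ONE VERTEX [+ one `φ`-reversing automorphism for the `{±1}` node].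
[cite: KozmaNitzan2024, §4 pp. 15–16 (boxes and their translates; Lemma 8)] [cite: MartineauTassion2017, §3.2]
-/

noncomputable section

namespace Summit.CriticalPhenomena.PercolationContinuityZ3.Theorems.Transplant

open SimpleGraph Literature.Probability.LatticeModels
open scoped Classical

variable {V : Type} {G : SimpleGraph V} [G.LocallyFinite]

/-- Frames preserve degrees. [folklore] -/
theorem degree_eq_of_iso (α : G ≃g G) (t : V) : G.degree (α t) = G.degree t := by
  rw [← card_neighborFinset_eq_degree, ← card_neighborFinset_eq_degree]
  have e : (G.neighborFinset t).map α.toEquiv.toEmbedding = G.neighborFinset (α t) := by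
    ext v
    rw [Finset.mem_map, mem_neighborFinset]
    constructor
    · rintro ⟨u, hu, rfl⟩
      rw [mem_neighborFinset] at hu
      exact α.map_adj_iff.2 hu
    · intro h
      refine ⟨α.symm v, ?_, by simp⟩
      rw [mem_neighborFinset]
      have h' := α.symm.map_adj_iff.2 h
      rwa [RelIso.symm_apply_apply] at h'
  rw [← e, Finset.card_map]

namespace PlanarSkeletonFrm

/-- **Base-vertex data for a frames-only skeleton**: the fields of `PlanarSkeletonFrm` with the degree bound DROPPED and the unit steps (ι)
required at the base vertices only. [cite: KozmaNitzan2024, §4 p. 16 (Lemma 8)] -/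
structure BaseData (G : SimpleGraph V) [G.LocallyFinite] where
  /-- the skeleton map -/
  φ : V → Site 2
  /-- 1-Lipschitz in the sup-norm along edges -/
  lip : ∀ ⦃u v : V⦄, G.Adj u v → ∀ i : Fin 2, |φ u i - φ v i| ≤ 1
  /-- finitely many base vertices -/
  types : Finset V
  /-- translating frames -/
  frame : ∀ v : V, ∃ t ∈ types, ∃ α : G ≃g G, α t = v ∧ ∀ w, φ (α w) = φ w + (φ v - φ t)
  /-- (ι) at the base vertices only -/
  step_base : ∀ t ∈ types, ∀ (i : Fin 2) (σ : ℤˣ), ∃ t' : V, G.Adj t t' ∧ φ t' = φ t + Pi.single i (σ : ℤ)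
  /-- (κ) connected cylinders at the base vertices -/
  cyl_connected : ∀ t ∈ types, ∀ ℓ : ℕ, 1 ≤ ℓ → (G.induce {w | φ w - φ t ∈ box 2 ℓ}).Connected

namespace BaseData

variable (B : BaseData G)

/-- Every degree is at most the largest base degree. [folklore] -/
theorem degree_le_sup (v : V) : G.degree v ≤ B.types.sup fun t => G.degree t := by
  obtain ⟨t, ht, α, hαt, -⟩ := B.frame v
  rw [← hαt, degree_eq_of_iso]
  exact Finset.le_sup (f := fun t => G.degree t) ht

/-- Unit steps everywhere, carried from the base vertices by the frames. [cite: KozmaNitzan2024, §4 p. 26 ((29))] -/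
theorem step (v : V) (i : Fin 2) (σ : ℤˣ) : ∃ v' : V, G.Adj v v' ∧ B.φ v' = B.φ v + Pi.single i (σ : ℤ) := by
  obtain ⟨t, ht, α, hαt, hα⟩ := B.frame v
  obtain ⟨t', hadj, hφ⟩ := B.step_base t ht i σ
  refine ⟨α t', ?_, ?_⟩
  · have h := α.map_adj_iff.2 hadj; rwa [hαt] at h
  · rw [hα t', hφ, ← hαt, hα t]; abel

/-- **The frames-only skeleton determined by base data** (degree bound and steps derived). [cite: KozmaNitzan2024, §4 p. 16 (Lemma 8)] -/
def toFrm : PlanarSkeletonFrm G where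
  φ := B.φ
  lip := B.lip
  types := B.types
  frame := B.frame
  Δ := B.types.sup fun t => G.degree t
  degree_le := B.degree_le_sup
  step := B.step
  cyl_connected := B.cyl_connected

/-- The chart of `toFrm`. [folklore] -/
@[simp] theorem toFrm_φ : B.toFrm.φ = B.φ := rfl

/-- The base vertices of `toFrm`. [folklore] -/
@[simp] theorem toFrm_types : B.toFrm.types = B.types := rfl

end BaseData

end PlanarSkeletonFrm

namespace PlanarSkeletonNeg

/-- **Base-vertex data for a `{±1}` skeleton**: `PlanarSkeletonFrm.BaseData` plus the central inversion at the base vertices.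
[cite: KozmaNitzan2024, §4 p. 16 (Lemma 8)] -/
structure BaseData (G : SimpleGraph V) [G.LocallyFinite] extends PlanarSkeletonFrm.BaseData G where
  /-- the central inversion at every base vertex: an automorphism fixing `t` and reversing the chart -/
  neg : ∀ t ∈ types, ∃ α : G ≃g G, α t = t ∧ ∀ w, φ (α w) - φ t = -(φ w - φ t)

namespace BaseData

variable (B : BaseData G)

/-- **The `{±1}` skeleton determined by base data** (degree bound and steps derived). [cite: KozmaNitzan2024, §4 p. 16 (Lemma 8)] -/
def toNeg : PlanarSkeletonNeg G where
  φ := B.φ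
  lip := B.lip
  types := B.types
  frame := B.frame
  neg := B.neg
  Δ := B.types.sup fun t => G.degree t
  degree_le := B.toBaseData.degree_le_sup
  step := B.toBaseData.step
  cyl_connected := B.cyl_connected

/-- The chart of `toNeg`. [folklore] -/
@[simp] theorem toNeg_φ : B.toNeg.φ = B.φ := rfl

/-- The base vertices of `toNeg`. [folklore] -/
@[simp] theorem toNeg_types : B.toNeg.types = B.types := rfl

end BaseData

end PlanarSkeletonNeg

end Summit.CriticalPhenomena.PercolationContinuityZ3.Theorems.Transplant

end
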